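import Summits.MatrixMultiplication.OmegaCensus.STPPKernelListerDataZ61
import Summits.MatrixMultiplication.OmegaCensus.STPPKernelListerSplit


/-!
# ω-census (abelian STPP census): kernel lister rows for `ℤ₆₁` (split form), file 21 of 74 (kernel computation)

HONEST FRAMING (pub-omega census; verbatim): lottery ticket; floor = certified bounds/negative ranges.
Census STRUCTURE (seat pub-omega-stpp-2 gen 29, 2026-08-29), family (b2).  One chunk of the root computation of the kernel lister at `n = 61` in SPLIT
form (`KLister.scanFirstSel2C`, `STPPKernelListerSplit.lean`): light first blocks (part 5 of 8: 50 shapes), second blocks unrestricted.  Twin estimate ≈ 2727 calls ≈ 1 s of kernel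
(HOME `pub-omega-stpp-2-g29/code/split_plan.py`, `klister_lean.py`).  Assembled in `STPPKernelListerCapstoneZ61.lean`.  Pure finite computation; nothing here is
progress on `ω`.
-/

namespace Summit.MatrixMultiplication.OmegaCensus.KLister

/-- First blocks of this file. [folklore] -/
def sel1Z61S21P5 : List Shape := [(10, 1, 2), (10, 2, 1), (20, 1, 1), (1, 1, 19), (1, 19, 1), (19, 1, 1), (1, 1, 18), (1, 2, 9), (1, 3, 6), (1, 6, 3), (1, 9, 2), (1, 18, 1), (2, 1, 9), (2, 9, 1), (3, 1, 6), (3, 6, 1), (6, 1, 3), (6, 3, 1), (9, 1, 2), (9, 2, 1), (18, 1, 1), (1, 1, 17), (1, 17, 1), (17, 1, 1), (1, 1, 16), (1, 2, 8), (1, 4, 4), (1, 8, 2), (1, 16, 1), (2, 1, 8), (2, 8, 1), (4, 1, 4), (4, 4, 1), (8, 1, 2), (8, 2, 1), (16, 1, 1), (1, 1, 15), (1, 3, 5), (1, 5, 3), (1, 15, 1), (3, 1, 5), (3, 5, 1), (5, 1, 3), (5, 3, 1), (15, 1, 1), (1, 1, 14), (1, 2, 7), (1, 7, 2), (1, 14,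 1), (2, 1, 7)]


set_option maxRecDepth 32768 in
set_option maxHeartbeats 4000000 in
/-- Rows of the kernel lister at `61` (split form) for this file's selections. [folklore] -/
theorem scanSel_Z61_S21P5 :
    scanFirstSel2C 61 deadZ61 (fun s => sel1Z61S21P5.contains s) (fun _ => true) chunksZ61 = true := by
  decide +kernel

end Summit.MatrixMultiplication.OmegaCensus.KLister
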